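import Literature.AnabelianGeometry.EtaleTheta.Discharge.Sec4Thm44KummerClassModel
import Literature.AnabelianGeometry.EtaleTheta.Discharge.Sec4Thm44OfConnectedTemperoid
import Literature.AnabelianGeometry.EtaleTheta.BiKummerThm44SubModelConnectedBinj
import Literature.AnabelianGeometry.EtaleTheta.BiKummerThm44SubModelConnectedBaseInj

/-!
# [EtTh] Thm 4.4 (iii), Kummer-class clause (T44-L16) AT THE GENUINE CONNECTED BASE `B^temp(Π^tp_X)⁰`

S. Mochizuki, *The étale theta function and its Frobenioid-theoretic manifestations*, Publ. RIMS **45** (2009)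
[MochizukiEtTh2009], Thm 4.4 (iii) PDF p.94 (printed p.320), last sentence: "Then the isomorphism
`H¹(H_{A₁}, μ_N(A₁)) ⥲ H¹(H_{A₂}, μ_N(A₂))` maps `κ_{f₁} ↦ κ_{f₂}` [cf. [FrdII] Def 2.1 (ii)]"
[cite: MochizukiEtTh2009, Thm 4.4 (iii) p.94].  abc-iut cell, layer L2, plan/L2/SUBDAG-EtTh-Thm44.md row T44-L16
(custodian lineage abc-iut-w5-d179), cone node `EtTh:Thm4.4(iii)`.  Seat abc-iut-L2-t3 (gen 4; author of T44-L16
`Thm44Hyp.PreservesKummerClass` / `preservesKummerClass_of`, `BiKummerThm44SubKummerClass.lean`, and of the model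
corollaries `Discharge/Sec4Thm44KummerClassModel.lean`).  PROOF-ONLY (0 `def`s); nothing landed is edited or restated.

STATE BEFORE THIS FILE.  T44-L16 is PROVED over the free §4 setting modulo its two input sub-nodes T44-L09c
(`GaloisCompatible`, h9) and T44-L10 (c) (`BiratCompatible`, h10) (`preservesKummerClass_of`), and at the model
instances `mkOfModel` / `mkOfModelCanonical` with `ψ = Ψ^birat` CONSTRUCTED modulo h9 only
(`preservesKummerClass_mkOfModel(Canonical)`, T44-L10 discharged by abc-iut-w5-d179's `biratCompatible_mkOfModel`).
At print's genuine base `D_i = B^temp(Π^tp_{X_i})⁰ = ConnectedPart (BTemp X_i.Pi)` (abc-iut-L2-t4's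
`mkOfConnectedTemperoid`) T44-L09c is abc-iut-w5-d013's THEOREM `galoisCompatible_mkOfConnectedTemperoid`
([SemiAnbd] Prop 3.2 / Thm A.4 over the temperoid), and the three cone nodes (i), (ii), (iii)-saturation ∧ roots are
closed there ⇐ {`hBinj₁`, `hBinj₂`, T44-L15b} (abc-iut-w5-d179 `thm44_mkOfConnectedTemperoid_of_hBinj`, p434227) —
WITHOUT the Kummer-class clause.

WHAT THIS FILE ADDS (compositions; every input a theorem of the tree):
* `Thm44Hyp.preservesKummerClass_mkOfConnectedTemperoid` — **T44-L16 at the genuine connected base with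
  `ψ = Ψ^birat` CONSTRUCTED, NO sub-node input left**: h9 := `galoisCompatible_mkOfConnectedTemperoid`,
  h10 := `biratCompatible_mkOfModel`; the only hypotheses are print's standing «`C_i` is a Frobenioid» / T44-L03
  (ANY proofs `hF₁ hF₂ h3` — proof-irrelevant parameters of `psiModel`);
* `…_of_hBinj` — the same with those standing hypotheses supplied from `hBinj₁ / hBinj₂` (abc-iut-L2-t3's
  `TemperedFrobenioid.isFrobenioid_of_structural` with [FrdII] Ex 1.3 (i) `connectedPart_isOfFSMType`, and
  `preservesFrobeniusStructure_mkOfConnectedTemperoid_of_hBinj`);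
* `Thm44Hyp.thm44_full_mkOfConnectedTemperoid_of_hBinj` — **[EtTh] Thm 4.4 (i) ∧ (ii) ∧ (iii) IN FULL (saturation AND
  Kummer class) ∧ (`N`-th roots) at the genuine connected base ⇐ {`hBinj₁`, `hBinj₂`, T44-L15b} and NOTHING ELSE**
  (p434227 ∧ this file's Kummer clause).
RESIDUAL of cone node `EtTh:Thm4.4(iii)` at the genuine base is therefore UNCHANGED by adding the Kummer-class clause:
{`hBinj ×2` (Def 3.3 (iii) data property; base-image form hBD, abc-iut-w5-d179 p436787), T44-L15b (faithful reading:
abc-iut-w6-d047 p437196)}.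

Universe note: as in `BiKummerKummerClass.lean` (Mathlib `groupCohomology` needs ring, group and module in ONE
universe), the `H¹`-level statements live at Hom- and monoid-universe `0`; since `ConnectedPart (BTemp Π)` has
`Hom`-universe that of `Π`, the base fields `K, K'`, the groups `Π^tp_{X_i}` and the Def 3.3 bases `D₀, D₀'` are
taken in `Type` here (the arithmetic case).  HONEST FRAMING: refereed pre-IUT material ([EtTh] 2009, [FrdI]/[FrdII]
2008, [SemiAnbd] 2006); every theorem is an implication for data so parametrised; nothing here asserts that such data
exist for an actual curve or bears on the disputed [IUTchIII] Cor. 3.12; typed ≠ proved — here PROVED (compositions).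
-/

noncomputable section

namespace Literature.AnabelianGeometry.EtaleTheta

open CategoryTheory Opposite Function Literature.AlgebraicGeometry.Frobenioids Literature.AnabelianGeometry.SemiGraphs

namespace BiKummerSetting

universe v₀

section Connected

variable {K : Type} [Field K] {K' : Type} [Field K'] {X₁ : SemiGraphs.TemperedArithmeticGroup.{0} K}
  {X₂ : SemiGraphs.TemperedArithmeticGroup.{0} K'} {D₀ : Type} [Category.{v₀} D₀] {D₀' : Type}
  [Category.{v₀} D₀'] {T₁ : RealifiedDivisorMonoids (D₀ := D₀) treeMonoidVocab.{0}}
  {T₂ : RealifiedDivisorMonoids (D₀ := D₀') treeMonoidVocab.{0}}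
  {IsRational₁ IsStrictlyRational₁ : ((ConnectedPart (BTemp X₁.Pi))ᵒᵖ ⥤ CommMonCat.{0}) → Prop}
  {IsRational₂ IsStrictlyRational₂ : ((ConnectedPart (BTemp X₂.Pi))ᵒᵖ ⥤ CommMonCat.{0}) → Prop}
  {tf₁ : TemperedFrobenioid T₁ (ConnectedPart (BTemp X₁.Pi))
    (treeCatVocab (ConnectedPart (BTemp X₁.Pi)) IsRational₁ IsStrictlyRational₁)}
  {hZ₁ : tf₁.monoidType = MonoidType.Z} {hP₁ : ∀ A : (ConnectedPart (BTemp X₁.Pi))ᵒᵖ, IsPerfect (tf₁.Φ.carrier A)}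
  {NH₁ : Subgroup (Field.absoluteGaloisGroup K) → tf₁.category → ℕ+ → Prop} {A₁ : tf₁.category}
  {hA₁ : PreFrobenioid.IsFrobeniusTrivial tf₁.toElem A₁} {hA₁' : SemiGraphs.IsGaloisObj A₁.base.obj}
  {tf₂ : TemperedFrobenioid T₂ (ConnectedPart (BTemp X₂.Pi))
    (treeCatVocab (ConnectedPart (BTemp X₂.Pi)) IsRational₂ IsStrictlyRational₂)}
  {hZ₂ : tf₂.monoidType = MonoidType.Z} {hP₂ : ∀ B : (ConnectedPart (BTemp X₂.Pi))ᵒᵖ, IsPerfect (tf₂.Φ.carrier B)}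
  {NH₂ : Subgroup (Field.absoluteGaloisGroup K') → tf₂.category → ℕ+ → Prop} {A₂ : tf₂.category}
  {hA₂ : PreFrobenioid.IsFrobeniusTrivial tf₂.toElem A₂} {hA₂' : SemiGraphs.IsGaloisObj A₂.base.obj}

/-- **T44-L16 (the Kummer-class clause of [EtTh] Thm 4.4 (iii)) AT THE GENUINE CONNECTED BASE `B^temp(Π^tp_X)⁰`,
with `ψ = Ψ^birat` CONSTRUCTED (`psiModel`) and NO sub-node input left**: the isomorphism
`H¹(H_{A₁}, μ_N(A₁)) ⥲ H¹(H_{A₂}, μ_N(A₂))` induced by `Ψ` (on `H_A` through T44-L09c — here abc-iut-w5-d013's theorem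
`galoisCompatible_mkOfConnectedTemperoid` — and on `μ_N` through T44-L10 (c) — abc-iut-w5-d179's
`biratCompatible_mkOfModel`) maps `κ_{f₁} ↦ κ_{f₂}`.  The parameters `hF₁ hF₂ h3` («`C_i` Frobenioid», T44-L03) are
print's standing hypotheses, ANY proofs. [cite: MochizukiEtTh2009, Thm 4.4 (iii) p.94] -/
theorem Thm44Hyp.preservesKummerClass_mkOfConnectedTemperoid
    (h : Thm44Hyp (mkOfConnectedTemperoid X₁ tf₁ hZ₁ hP₁ NH₁ A₁ hA₁ hA₁')
      (mkOfConnectedTemperoid X₂ tf₂ hZ₂ hP₂ NH₂ A₂ hA₂ hA₂'))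
    (hF₁ : PreFrobenioid.IsFrobenioid tf₁.toElem) (hF₂ : PreFrobenioid.IsFrobenioid tf₂.toElem)
    (h3 : h.PreservesFrobeniusStructure) :
    h.PreservesKummerClass (h.psiModel hF₁ hF₂ h3)
      (h.galoisCompatible_mkOfConnectedTemperoid _ _ _ _ _ _ _ _ _ _ _ _ _ _)
      (h.biratCompatible_mkOfModel hF₁ hF₂ h3) :=
  h.preservesKummerClass_of _ _ _

/-- **T44-L16 at the genuine connected base from `hBinj₁ / hBinj₂` ALONE**: the standing hypotheses «`C_i` is a
Frobenioid» and T44-L03 of `preservesKummerClass_mkOfConnectedTemperoid` supplied from the injectivity of the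
pull-backs of `B₀^Λ` (abc-iut-L2-t3's `TemperedFrobenioid.isFrobenioid_of_structural` with [FrdII] Ex 1.3 (i)
`connectedPart_isOfFSMType`; `preservesFrobeniusStructure_mkOfConnectedTemperoid_of_hBinj`).
[cite: MochizukiEtTh2009, Thm 4.4 (iii) p.94] -/
theorem Thm44Hyp.preservesKummerClass_mkOfConnectedTemperoid_of_hBinj
    (h : Thm44Hyp (mkOfConnectedTemperoid X₁ tf₁ hZ₁ hP₁ NH₁ A₁ hA₁ hA₁')
      (mkOfConnectedTemperoid X₂ tf₂ hZ₂ hP₂ NH₂ A₂ hA₂ hA₂'))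
    (hBinj₁ : ∀ {Y Y' : D₀ᵒᵖ} (g : Y ⟶ Y'), Injective (T₁.BΛ.map g).hom)
    (hBinj₂ : ∀ {Y Y' : D₀'ᵒᵖ} (g : Y ⟶ Y'), Injective (T₂.BΛ.map g).hom) :
    h.PreservesKummerClass
      (h.psiModel (tf₁.isFrobenioid_of_structural hBinj₁ fun α hα =>
        (QuasiTemperoid.BTempConnected.connectedPart_isOfFSMType (G := X₁.Pi)).isIso_of_isFSM α hα)
        (tf₂.isFrobenioid_of_structural hBinj₂ fun α hα =>
        (QuasiTemperoid.BTempConnected.connectedPart_isOfFSMType (G := X₂.Pi)).isIso_of_isFSM α hα)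
        (h.preservesFrobeniusStructure_mkOfConnectedTemperoid_of_hBinj hBinj₁ hBinj₂))
      (h.galoisCompatible_mkOfConnectedTemperoid _ _ _ _ _ _ _ _ _ _ _ _ _ _)
      (h.biratCompatible_mkOfModel
        (tf₁.isFrobenioid_of_structural hBinj₁ fun α hα =>
          (QuasiTemperoid.BTempConnected.connectedPart_isOfFSMType (G := X₁.Pi)).isIso_of_isFSM α hα)
        (tf₂.isFrobenioid_of_structural hBinj₂ fun α hα =>
          (QuasiTemperoid.BTempConnected.connectedPart_isOfFSMType (G := X₂.Pi)).isIso_of_isFSM α hα)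
        (h.preservesFrobeniusStructure_mkOfConnectedTemperoid_of_hBinj hBinj₁ hBinj₂)) :=
  h.preservesKummerClass_mkOfConnectedTemperoid _ _ _

/-- **[EtTh] Thm 4.4 (iii) IN FULL at the genuine connected base** — the saturation clause `Thm44_iii` AND the
Kummer-class clause — for the CONSTRUCTED `ψ = psiModel hF₁ hF₂ h3` over ANY proofs of the standing hypotheses,
⇐ {`hBinj₁`, `hBinj₂`, T44-L15b}. [cite: MochizukiEtTh2009, Thm 4.4 (iii) p.94] -/
theorem Thm44Hyp.thm44_iii_and_kummerClass_mkOfConnectedTemperoid_of_hBinj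
    (h : Thm44Hyp (mkOfConnectedTemperoid X₁ tf₁ hZ₁ hP₁ NH₁ A₁ hA₁ hA₁')
      (mkOfConnectedTemperoid X₂ tf₂ hZ₂ hP₂ NH₂ A₂ hA₂ hA₂'))
    (hF₁ : PreFrobenioid.IsFrobenioid tf₁.toElem) (hF₂ : PreFrobenioid.IsFrobenioid tf₂.toElem)
    (h3 : h.PreservesFrobeniusStructure)
    (hBinj₁ : ∀ {Y Y' : D₀ᵒᵖ} (g : Y ⟶ Y'), Injective (T₁.BΛ.map g).hom)
    (hBinj₂ : ∀ {Y Y' : D₀'ᵒᵖ} (g : Y ⟶ Y'), Injective (T₂.BΛ.map g).hom) (h15 : h.PreservesNHSaturatedBsFld) :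
    Thm44_iii h (h.psiModel hF₁ hF₂ h3) ∧
      h.PreservesKummerClass (h.psiModel hF₁ hF₂ h3)
        (h.galoisCompatible_mkOfConnectedTemperoid _ _ _ _ _ _ _ _ _ _ _ _ _ _)
        (h.biratCompatible_mkOfModel hF₁ hF₂ h3) :=
  ⟨h.thm44_iii_mkOfConnectedTemperoid_of_hBinj hF₁ hF₂ h3 hBinj₁ hBinj₂ h15,
    h.preservesKummerClass_mkOfConnectedTemperoid hF₁ hF₂ h3⟩

/-- **[EtTh] Thm 4.4 (i) ∧ (ii) ∧ (iii) IN FULL (saturation ∧ Kummer class) ∧ (`N`-th roots) AT THE GENUINE CONNECTED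
BASE `B^temp(Π^tp_X)⁰` ⇐ {`hBinj₁`, `hBinj₂`, T44-L15b} and NOTHING ELSE** — abc-iut-w5-d179's
`thm44_mkOfConnectedTemperoid_of_hBinj` (p434227) with the Kummer-class clause of (iii) added; every [SemiAnbd] /
[FrdI] / [FrdII] input of the printed proof (p.95) is a theorem of the tree at this base, and NO plan/FACT-LIST fact is
an input.  `hF₁ hF₂ h3` are ANY proofs of the standing hypotheses (themselves consequences of `hBinj`, cf.
`thm44_full_mkOfConnectedTemperoid_of_hBinj'`). [cite: MochizukiEtTh2009, Thm 4.4 p.94] -/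
theorem Thm44Hyp.thm44_full_mkOfConnectedTemperoid_of_hBinj
    (h : Thm44Hyp (mkOfConnectedTemperoid X₁ tf₁ hZ₁ hP₁ NH₁ A₁ hA₁ hA₁')
      (mkOfConnectedTemperoid X₂ tf₂ hZ₂ hP₂ NH₂ A₂ hA₂ hA₂'))
    (hF₁ : PreFrobenioid.IsFrobenioid tf₁.toElem) (hF₂ : PreFrobenioid.IsFrobenioid tf₂.toElem)
    (h3 : h.PreservesFrobeniusStructure)
    (hBinj₁ : ∀ {Y Y' : D₀ᵒᵖ} (g : Y ⟶ Y'), Injective (T₁.BΛ.map g).hom)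
    (hBinj₂ : ∀ {Y Y' : D₀'ᵒᵖ} (g : Y ⟶ Y'), Injective (T₂.BΛ.map g).hom) (h15 : h.PreservesNHSaturatedBsFld) :
    Thm44_i h ∧ Thm44_ii h (h.psiModel hF₁ hF₂ h3) ∧ Thm44_iii h (h.psiModel hF₁ hF₂ h3) ∧
      h.PreservesKummerClass (h.psiModel hF₁ hF₂ h3)
        (h.galoisCompatible_mkOfConnectedTemperoid _ _ _ _ _ _ _ _ _ _ _ _ _ _)
        (h.biratCompatible_mkOfModel hF₁ hF₂ h3) ∧
      h.PreservesNthRoots (h.psiModel hF₁ hF₂ h3) (fun φ f => tf₁.pullFracModel φ f)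
        (fun φ f => tf₂.pullFracModel φ f) := by
  obtain ⟨h₁, h₂, h₃, h₄⟩ := h.thm44_mkOfConnectedTemperoid_of_hBinj hF₁ hF₂ h3 hBinj₁ hBinj₂ h15
  exact ⟨h₁, h₂, h₃, h.preservesKummerClass_mkOfConnectedTemperoid hF₁ hF₂ h3, h₄⟩

/-- **The same with the ψ-slot proofs themselves supplied from `hBinj`** — literally ⇐ {`hBinj₁`, `hBinj₂`, T44-L15b}.
[cite: MochizukiEtTh2009, Thm 4.4 p.94] -/
theorem Thm44Hyp.thm44_full_mkOfConnectedTemperoid_of_hBinj'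
    (h : Thm44Hyp (mkOfConnectedTemperoid X₁ tf₁ hZ₁ hP₁ NH₁ A₁ hA₁ hA₁')
      (mkOfConnectedTemperoid X₂ tf₂ hZ₂ hP₂ NH₂ A₂ hA₂ hA₂'))
    (hBinj₁ : ∀ {Y Y' : D₀ᵒᵖ} (g : Y ⟶ Y'), Injective (T₁.BΛ.map g).hom)
    (hBinj₂ : ∀ {Y Y' : D₀'ᵒᵖ} (g : Y ⟶ Y'), Injective (T₂.BΛ.map g).hom) (h15 : h.PreservesNHSaturatedBsFld) :
    Thm44_i h ∧
      Thm44_ii h (h.psiModel (tf₁.isFrobenioid_of_structural hBinj₁ fun α hα =>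
        (QuasiTemperoid.BTempConnected.connectedPart_isOfFSMType (G := X₁.Pi)).isIso_of_isFSM α hα)
        (tf₂.isFrobenioid_of_structural hBinj₂ fun α hα =>
        (QuasiTemperoid.BTempConnected.connectedPart_isOfFSMType (G := X₂.Pi)).isIso_of_isFSM α hα)
        (h.preservesFrobeniusStructure_mkOfConnectedTemperoid_of_hBinj hBinj₁ hBinj₂)) ∧
      Thm44_iii h (h.psiModel (tf₁.isFrobenioid_of_structural hBinj₁ fun α hα =>
        (QuasiTemperoid.BTempConnected.connectedPart_isOfFSMType (G := X₁.Pi)).isIso_of_isFSM α hα)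
        (tf₂.isFrobenioid_of_structural hBinj₂ fun α hα =>
        (QuasiTemperoid.BTempConnected.connectedPart_isOfFSMType (G := X₂.Pi)).isIso_of_isFSM α hα)
        (h.preservesFrobeniusStructure_mkOfConnectedTemperoid_of_hBinj hBinj₁ hBinj₂)) ∧
      h.PreservesKummerClass (h.psiModel (tf₁.isFrobenioid_of_structural hBinj₁ fun α hα =>
        (QuasiTemperoid.BTempConnected.connectedPart_isOfFSMType (G := X₁.Pi)).isIso_of_isFSM α hα)
        (tf₂.isFrobenioid_of_structural hBinj₂ fun α hα =>
        (QuasiTemperoid.BTempConnected.connectedPart_isOfFSMType (G := X₂.Pi)).isIso_of_isFSM α hα)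
        (h.preservesFrobeniusStructure_mkOfConnectedTemperoid_of_hBinj hBinj₁ hBinj₂))
        (h.galoisCompatible_mkOfConnectedTemperoid _ _ _ _ _ _ _ _ _ _ _ _ _ _)
        (h.biratCompatible_mkOfModel
          (tf₁.isFrobenioid_of_structural hBinj₁ fun α hα =>
            (QuasiTemperoid.BTempConnected.connectedPart_isOfFSMType (G := X₁.Pi)).isIso_of_isFSM α hα)
          (tf₂.isFrobenioid_of_structural hBinj₂ fun α hα =>
            (QuasiTemperoid.BTempConnected.connectedPart_isOfFSMType (G := X₂.Pi)).isIso_of_isFSM α hα)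
          (h.preservesFrobeniusStructure_mkOfConnectedTemperoid_of_hBinj hBinj₁ hBinj₂)) ∧
      h.PreservesNthRoots (h.psiModel (tf₁.isFrobenioid_of_structural hBinj₁ fun α hα =>
        (QuasiTemperoid.BTempConnected.connectedPart_isOfFSMType (G := X₁.Pi)).isIso_of_isFSM α hα)
        (tf₂.isFrobenioid_of_structural hBinj₂ fun α hα =>
        (QuasiTemperoid.BTempConnected.connectedPart_isOfFSMType (G := X₂.Pi)).isIso_of_isFSM α hα)
        (h.preservesFrobeniusStructure_mkOfConnectedTemperoid_of_hBinj hBinj₁ hBinj₂))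
        (fun φ f => tf₁.pullFracModel φ f) (fun φ f => tf₂.pullFracModel φ f) :=
  h.thm44_full_mkOfConnectedTemperoid_of_hBinj _ _ _ hBinj₁ hBinj₂ h15

/-! ### v2 (append-only): the BASE-IMAGE form `hBD` of the injectivity input (census A9 form of record)

abc-iut-w5-d179's `BiKummerThm44SubModelConnectedBaseInj.lean` (p436787) re-keys the genuine-base closers on
`hBD_i` — injectivity of the pull-backs of `B₀^Λ` along the base maps `tf_i.base.map α` of ARROWS OF
`D_i = B^temp(Π^tp_{X_i})⁰` only (connected targets, hence surjective maps of `Π`-sets) — instead of the `D₀`-wide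
`hBinj_i` (which is FALSE over bases with an empty object).  The Kummer-class clause needs no injectivity at all, so
the full statement transfers verbatim. -/

/-- **[EtTh] Thm 4.4 (i) ∧ (ii) ∧ (iii) IN FULL (saturation ∧ Kummer class) ∧ (`N`-th roots) AT THE GENUINE
CONNECTED BASE ⇐ {`hBD₁`, `hBD₂`, T44-L15b} and NOTHING ELSE** — the base-image form: abc-iut-w5-d179's
`thm44_mkOfConnectedTemperoid_of_baseInj` (p436787) with the Kummer-class clause of (iii) added (`ψ = psiModel`
CONSTRUCTED over ANY proofs `hF₁ hF₂ h3` of the standing hypotheses, themselves consequences of `hBD`: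
`isFrobenioid_connectedPart_of_baseInj`, `preservesFrobeniusStructure_of_isOfFSMType`).
[cite: MochizukiEtTh2009, Thm 4.4 p.94] -/
theorem Thm44Hyp.thm44_full_mkOfConnectedTemperoid_of_baseInj
    (h : Thm44Hyp (mkOfConnectedTemperoid X₁ tf₁ hZ₁ hP₁ NH₁ A₁ hA₁ hA₁')
      (mkOfConnectedTemperoid X₂ tf₂ hZ₂ hP₂ NH₂ A₂ hA₂ hA₂'))
    (hF₁ : PreFrobenioid.IsFrobenioid tf₁.toElem) (hF₂ : PreFrobenioid.IsFrobenioid tf₂.toElem)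
    (h3 : h.PreservesFrobeniusStructure)
    (hBD₁ : ∀ {A B : ConnectedPart (BTemp X₁.Pi)} (α : B ⟶ A), Injective (T₁.BΛ.map (tf₁.base.map α).op).hom)
    (hBD₂ : ∀ {A B : ConnectedPart (BTemp X₂.Pi)} (α : B ⟶ A), Injective (T₂.BΛ.map (tf₂.base.map α).op).hom)
    (h15 : h.PreservesNHSaturatedBsFld) :
    Thm44_i h ∧ Thm44_ii h (h.psiModel hF₁ hF₂ h3) ∧ Thm44_iii h (h.psiModel hF₁ hF₂ h3) ∧
      h.PreservesKummerClass (h.psiModel hF₁ hF₂ h3)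
        (h.galoisCompatible_mkOfConnectedTemperoid _ _ _ _ _ _ _ _ _ _ _ _ _ _)
        (h.biratCompatible_mkOfModel hF₁ hF₂ h3) ∧
      h.PreservesNthRoots (h.psiModel hF₁ hF₂ h3) (fun φ f => tf₁.pullFracModel φ f)
        (fun φ f => tf₂.pullFracModel φ f) := by
  obtain ⟨h₁, h₂, h₃, h₄⟩ :=
    Thm44Hyp.thm44_mkOfConnectedTemperoid_of_baseInj tf₁ hZ₁ hP₁ NH₁ A₁ hA₁ hA₁' tf₂ hZ₂ hP₂ NH₂ A₂ hA₂ hA₂' h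
      hF₁ hF₂ h3 hBD₁ hBD₂ h15
  exact ⟨h₁, h₂, h₃, h.preservesKummerClass_mkOfConnectedTemperoid hF₁ hF₂ h3, h₄⟩

/-- **The same with every ψ-slot proof supplied from `hBD`** — literally ⇐ {`hBD₁`, `hBD₂`, T44-L15b}.
[cite: MochizukiEtTh2009, Thm 4.4 p.94] -/
theorem Thm44Hyp.thm44_full_mkOfConnectedTemperoid_of_baseInj'
    (h : Thm44Hyp (mkOfConnectedTemperoid X₁ tf₁ hZ₁ hP₁ NH₁ A₁ hA₁ hA₁')
      (mkOfConnectedTemperoid X₂ tf₂ hZ₂ hP₂ NH₂ A₂ hA₂ hA₂'))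
    (hBD₁ : ∀ {A B : ConnectedPart (BTemp X₁.Pi)} (α : B ⟶ A), Injective (T₁.BΛ.map (tf₁.base.map α).op).hom)
    (hBD₂ : ∀ {A B : ConnectedPart (BTemp X₂.Pi)} (α : B ⟶ A), Injective (T₂.BΛ.map (tf₂.base.map α).op).hom)
    (h15 : h.PreservesNHSaturatedBsFld) :
    Thm44_i h ∧
      Thm44_ii h (h.psiModel (tf₁.isFrobenioid_connectedPart_of_baseInj hBD₁)
        (tf₂.isFrobenioid_connectedPart_of_baseInj hBD₂)
        (h.preservesFrobeniusStructure_of_isOfFSMType (tf₁.isMonoidOn_ratFnFunctor_connectedPart_of_baseInj hBD₁)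
          (tf₂.isMonoidOn_ratFnFunctor_connectedPart_of_baseInj hBD₂)
          QuasiTemperoid.BTempConnected.connectedPart_isOfFSMType
          QuasiTemperoid.BTempConnected.connectedPart_isOfFSMType)) ∧
      Thm44_iii h (h.psiModel (tf₁.isFrobenioid_connectedPart_of_baseInj hBD₁)
        (tf₂.isFrobenioid_connectedPart_of_baseInj hBD₂)
        (h.preservesFrobeniusStructure_of_isOfFSMType (tf₁.isMonoidOn_ratFnFunctor_connectedPart_of_baseInj hBD₁)
          (tf₂.isMonoidOn_ratFnFunctor_connectedPart_of_baseInj hBD₂)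
          QuasiTemperoid.BTempConnected.connectedPart_isOfFSMType
          QuasiTemperoid.BTempConnected.connectedPart_isOfFSMType)) ∧
      h.PreservesKummerClass (h.psiModel (tf₁.isFrobenioid_connectedPart_of_baseInj hBD₁)
        (tf₂.isFrobenioid_connectedPart_of_baseInj hBD₂)
        (h.preservesFrobeniusStructure_of_isOfFSMType (tf₁.isMonoidOn_ratFnFunctor_connectedPart_of_baseInj hBD₁)
          (tf₂.isMonoidOn_ratFnFunctor_connectedPart_of_baseInj hBD₂)
          QuasiTemperoid.BTempConnected.connectedPart_isOfFSMType
          QuasiTemperoid.BTempConnected.connectedPart_isOfFSMType))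
        (h.galoisCompatible_mkOfConnectedTemperoid _ _ _ _ _ _ _ _ _ _ _ _ _ _)
        (h.biratCompatible_mkOfModel (tf₁.isFrobenioid_connectedPart_of_baseInj hBD₁)
          (tf₂.isFrobenioid_connectedPart_of_baseInj hBD₂)
          (h.preservesFrobeniusStructure_of_isOfFSMType (tf₁.isMonoidOn_ratFnFunctor_connectedPart_of_baseInj hBD₁)
            (tf₂.isMonoidOn_ratFnFunctor_connectedPart_of_baseInj hBD₂)
            QuasiTemperoid.BTempConnected.connectedPart_isOfFSMType
            QuasiTemperoid.BTempConnected.connectedPart_isOfFSMType)) ∧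
      h.PreservesNthRoots (h.psiModel (tf₁.isFrobenioid_connectedPart_of_baseInj hBD₁)
        (tf₂.isFrobenioid_connectedPart_of_baseInj hBD₂)
        (h.preservesFrobeniusStructure_of_isOfFSMType (tf₁.isMonoidOn_ratFnFunctor_connectedPart_of_baseInj hBD₁)
          (tf₂.isMonoidOn_ratFnFunctor_connectedPart_of_baseInj hBD₂)
          QuasiTemperoid.BTempConnected.connectedPart_isOfFSMType
          QuasiTemperoid.BTempConnected.connectedPart_isOfFSMType))
        (fun φ f => tf₁.pullFracModel φ f) (fun φ f => tf₂.pullFracModel φ f) :=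
  h.thm44_full_mkOfConnectedTemperoid_of_baseInj _ _ _ hBD₁ hBD₂ h15

end Connected

end BiKummerSetting

end Literature.AnabelianGeometry.EtaleTheta

end
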